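import Mathlib
import HarnessLib
import Summits.HubbardSuperconductivity.HubbardSuperconductivity.Theorems.KLProgrammeKLRegimeVolumeLimitScalarRate

/-!
# Route `KLProgramme` — VL child `KLRegimeVolumeLimitV12` (stmt-HubbardSuperconductivity-19858), Cauchy stub `stub_vl_twoVolumeRate`:
# rate algebra III — the EXISTENTIAL form «∃ D ρ, ρ → 0 ∧ two-volume rate beyond fixed thresholds» is closed under the algebra
# (cell gate-hubbard-kl, seat hubbard-kl-k3c4-p1 g4; packaging of `…CauchyTermwise` §4 and `…ScalarRate` for multi-step assemblies)

For a volume family `S L M : FreqMomentum L M → Fin 2 → ℂ` and FIXED thresholds `(L₀, Mth)`, write informally `Rate∃(S)` for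
`∃ D ρ, Tendsto ρ atTop (𝓝 0) ∧ ∀ L ≥ L₀ ∀ M ≥ Mth L ∀ L′ ≥ L ∀ M′ ≥ Mth L′ ∀ σ ω ω′ (equal Matsubara integers) ∀ k k′,
‖S_{L,M}((ω,k),σ) − S_{L′,M′}((ω′,k′),σ)‖ ≤ ρ L + D·Σ_i |p_k i − p′_{k′} i|_𝕋` (the conclusion shape of the registered stub, thresholds fixed).
This file proves that `Rate∃` is preserved by: enlarging thresholds (`klre_mono`), sums (`klre_add`), differences (`klre_sub`), negation
(`klre_neg`), constant multiples (`klre_const_mul`), products of BOUNDED families (`klre_mul`), and dressing by a bounded `2π`-periodic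
Lipschitz symbol read on the grid (`klre_dressing_mul`); and that grid-exact symbol families (`klre_of_gridExact`) and momentum-constant
families with an iterated limit (`klre_of_iterLimit`) are in `Rate∃`.  Each is the corresponding pointwise rule of `…CauchyTermwise` /
`…ScalarRate` plus `Tendsto` arithmetic.  Pure bookkeeping; nothing is asserted about the model.
-/

noncomputable section

namespace Summit.HubbardSuperconductivity.HubbardSuperconductivity.Theorems.KLRegimeSplit

set_option linter.dupNamespace false -- summit = problem name (single-conjunct summit), D-0017

open Filter Topology Finset Literature.MathematicalPhysics.QuantumLattice Literature.Probability.LatticeModels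
open Summit.HubbardSuperconductivity.HubbardSuperconductivity.Theorems.KLProgrammeLegKernels

section Algebra

variable {S T : ∀ (L M : ℕ) [NeZero L] [NeZero M], FreqMomentum L M → Fin 2 → ℂ} {L₀ : ℕ} {Mth : ℕ → ℕ}

/-- **Enlarging the thresholds** preserves `Rate∃`. [folklore] -/
theorem klre_mono {L₀' : ℕ} {Mth' : ℕ → ℕ} (hL₀ : L₀ ≤ L₀') (hMth : ∀ L, Mth L ≤ Mth' L)
    (hS : ∃ D : ℝ, ∃ ρ : ℕ → ℝ, Tendsto ρ atTop (𝓝 0) ∧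
      ∀ (L : ℕ) [NeZero L], L₀ ≤ L → ∀ (M : ℕ) [NeZero M], Mth L ≤ M →
        ∀ (L' : ℕ) [NeZero L'], L ≤ L' → ∀ (M' : ℕ) [NeZero M'], Mth L' ≤ M' →
          ∀ (σ : Fin 2) (ω : MatsubaraIdx M) (ω' : MatsubaraIdx M'), matsubaraInt M ω = matsubaraInt M' ω' →
            ∀ (k : TorusSite 2 L) (k' : TorusSite 2 L'),
              ‖S L M (ω, k) σ - S L' M' (ω', k') σ‖ ≤ ρ L + D * ∑ i, torusAbs (latticeMomentum L k i - latticeMomentum L' k' i)) :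
    ∃ D : ℝ, ∃ ρ : ℕ → ℝ, Tendsto ρ atTop (𝓝 0) ∧
      ∀ (L : ℕ) [NeZero L], L₀' ≤ L → ∀ (M : ℕ) [NeZero M], Mth' L ≤ M →
        ∀ (L' : ℕ) [NeZero L'], L ≤ L' → ∀ (M' : ℕ) [NeZero M'], Mth' L' ≤ M' →
          ∀ (σ : Fin 2) (ω : MatsubaraIdx M) (ω' : MatsubaraIdx M'), matsubaraInt M ω = matsubaraInt M' ω' →
            ∀ (k : TorusSite 2 L) (k' : TorusSite 2 L'),
              ‖S L M (ω, k) σ - S L' M' (ω', k') σ‖ ≤ ρ L + D * ∑ i, torusAbs (latticeMomentum L k i - latticeMomentum L' k' i) := by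
  obtain ⟨D, ρ, hρ, h⟩ := hS
  exact ⟨D, ρ, hρ, twoVolumeRate_mono hL₀ hMth h⟩

/-- **Sums** preserve `Rate∃`. [folklore] -/
theorem klre_add
    (hS : ∃ D : ℝ, ∃ ρ : ℕ → ℝ, Tendsto ρ atTop (𝓝 0) ∧
      ∀ (L : ℕ) [NeZero L], L₀ ≤ L → ∀ (M : ℕ) [NeZero M], Mth L ≤ M →
        ∀ (L' : ℕ) [NeZero L'], L ≤ L' → ∀ (M' : ℕ) [NeZero M'], Mth L' ≤ M' →
          ∀ (σ : Fin 2) (ω : MatsubaraIdx M) (ω' : MatsubaraIdx M'), matsubaraInt M ω = matsubaraInt M' ω' →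
            ∀ (k : TorusSite 2 L) (k' : TorusSite 2 L'),
              ‖S L M (ω, k) σ - S L' M' (ω', k') σ‖ ≤ ρ L + D * ∑ i, torusAbs (latticeMomentum L k i - latticeMomentum L' k' i))
    (hT : ∃ D : ℝ, ∃ ρ : ℕ → ℝ, Tendsto ρ atTop (𝓝 0) ∧
      ∀ (L : ℕ) [NeZero L], L₀ ≤ L → ∀ (M : ℕ) [NeZero M], Mth L ≤ M →
        ∀ (L' : ℕ) [NeZero L'], L ≤ L' → ∀ (M' : ℕ) [NeZero M'], Mth L' ≤ M' →
          ∀ (σ : Fin 2) (ω : MatsubaraIdx M) (ω' : MatsubaraIdx M'), matsubaraInt M ω = matsubaraInt M' ω' →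
            ∀ (k : TorusSite 2 L) (k' : TorusSite 2 L'),
              ‖T L M (ω, k) σ - T L' M' (ω', k') σ‖ ≤ ρ L + D * ∑ i, torusAbs (latticeMomentum L k i - latticeMomentum L' k' i)) :
    ∃ D : ℝ, ∃ ρ : ℕ → ℝ, Tendsto ρ atTop (𝓝 0) ∧
      ∀ (L : ℕ) [NeZero L], L₀ ≤ L → ∀ (M : ℕ) [NeZero M], Mth L ≤ M →
        ∀ (L' : ℕ) [NeZero L'], L ≤ L' → ∀ (M' : ℕ) [NeZero M'], Mth L' ≤ M' →
          ∀ (σ : Fin 2) (ω : MatsubaraIdx M) (ω' : MatsubaraIdx M'), matsubaraInt M ω = matsubaraInt M' ω' →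
            ∀ (k : TorusSite 2 L) (k' : TorusSite 2 L'),
              ‖(S L M (ω, k) σ + T L M (ω, k) σ) - (S L' M' (ω', k') σ + T L' M' (ω', k') σ)‖ ≤
                ρ L + D * ∑ i, torusAbs (latticeMomentum L k i - latticeMomentum L' k' i) := by
  obtain ⟨D₁, ρ₁, hρ₁, h₁⟩ := hS
  obtain ⟨D₂, ρ₂, hρ₂, h₂⟩ := hT
  exact ⟨D₁ + D₂, fun L => ρ₁ L + ρ₂ L, by simpa using hρ₁.add hρ₂, twoVolumeRate_add h₁ h₂⟩

/-- **Differences** preserve `Rate∃`. [folklore] -/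
theorem klre_sub
    (hS : ∃ D : ℝ, ∃ ρ : ℕ → ℝ, Tendsto ρ atTop (𝓝 0) ∧
      ∀ (L : ℕ) [NeZero L], L₀ ≤ L → ∀ (M : ℕ) [NeZero M], Mth L ≤ M →
        ∀ (L' : ℕ) [NeZero L'], L ≤ L' → ∀ (M' : ℕ) [NeZero M'], Mth L' ≤ M' →
          ∀ (σ : Fin 2) (ω : MatsubaraIdx M) (ω' : MatsubaraIdx M'), matsubaraInt M ω = matsubaraInt M' ω' →
            ∀ (k : TorusSite 2 L) (k' : TorusSite 2 L'),
              ‖S L M (ω, k) σ - S L' M' (ω', k') σ‖ ≤ ρ L + D * ∑ i, torusAbs (latticeMomentum L k i - latticeMomentum L' k' i))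
    (hT : ∃ D : ℝ, ∃ ρ : ℕ → ℝ, Tendsto ρ atTop (𝓝 0) ∧
      ∀ (L : ℕ) [NeZero L], L₀ ≤ L → ∀ (M : ℕ) [NeZero M], Mth L ≤ M →
        ∀ (L' : ℕ) [NeZero L'], L ≤ L' → ∀ (M' : ℕ) [NeZero M'], Mth L' ≤ M' →
          ∀ (σ : Fin 2) (ω : MatsubaraIdx M) (ω' : MatsubaraIdx M'), matsubaraInt M ω = matsubaraInt M' ω' →
            ∀ (k : TorusSite 2 L) (k' : TorusSite 2 L'),
              ‖T L M (ω, k) σ - T L' M' (ω', k') σ‖ ≤ ρ L + D * ∑ i, torusAbs (latticeMomentum L k i - latticeMomentum L' k' i)) :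
    ∃ D : ℝ, ∃ ρ : ℕ → ℝ, Tendsto ρ atTop (𝓝 0) ∧
      ∀ (L : ℕ) [NeZero L], L₀ ≤ L → ∀ (M : ℕ) [NeZero M], Mth L ≤ M →
        ∀ (L' : ℕ) [NeZero L'], L ≤ L' → ∀ (M' : ℕ) [NeZero M'], Mth L' ≤ M' →
          ∀ (σ : Fin 2) (ω : MatsubaraIdx M) (ω' : MatsubaraIdx M'), matsubaraInt M ω = matsubaraInt M' ω' →
            ∀ (k : TorusSite 2 L) (k' : TorusSite 2 L'),
              ‖(S L M (ω, k) σ - T L M (ω, k) σ) - (S L' M' (ω', k') σ - T L' M' (ω', k') σ)‖ ≤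
                ρ L + D * ∑ i, torusAbs (latticeMomentum L k i - latticeMomentum L' k' i) := by
  obtain ⟨D₁, ρ₁, hρ₁, h₁⟩ := hS
  obtain ⟨D₂, ρ₂, hρ₂, h₂⟩ := hT
  exact ⟨D₁ + D₂, fun L => ρ₁ L + ρ₂ L, by simpa using hρ₁.add hρ₂, twoVolumeRate_sub h₁ h₂⟩

/-- **Negation** preserves `Rate∃`. [folklore] -/
theorem klre_neg
    (hS : ∃ D : ℝ, ∃ ρ : ℕ → ℝ, Tendsto ρ atTop (𝓝 0) ∧
      ∀ (L : ℕ) [NeZero L], L₀ ≤ L → ∀ (M : ℕ) [NeZero M], Mth L ≤ M →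
        ∀ (L' : ℕ) [NeZero L'], L ≤ L' → ∀ (M' : ℕ) [NeZero M'], Mth L' ≤ M' →
          ∀ (σ : Fin 2) (ω : MatsubaraIdx M) (ω' : MatsubaraIdx M'), matsubaraInt M ω = matsubaraInt M' ω' →
            ∀ (k : TorusSite 2 L) (k' : TorusSite 2 L'),
              ‖S L M (ω, k) σ - S L' M' (ω', k') σ‖ ≤ ρ L + D * ∑ i, torusAbs (latticeMomentum L k i - latticeMomentum L' k' i)) :
    ∃ D : ℝ, ∃ ρ : ℕ → ℝ, Tendsto ρ atTop (𝓝 0) ∧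
      ∀ (L : ℕ) [NeZero L], L₀ ≤ L → ∀ (M : ℕ) [NeZero M], Mth L ≤ M →
        ∀ (L' : ℕ) [NeZero L'], L ≤ L' → ∀ (M' : ℕ) [NeZero M'], Mth L' ≤ M' →
          ∀ (σ : Fin 2) (ω : MatsubaraIdx M) (ω' : MatsubaraIdx M'), matsubaraInt M ω = matsubaraInt M' ω' →
            ∀ (k : TorusSite 2 L) (k' : TorusSite 2 L'),
              ‖-S L M (ω, k) σ - -S L' M' (ω', k') σ‖ ≤ ρ L + D * ∑ i, torusAbs (latticeMomentum L k i - latticeMomentum L' k' i) := by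
  obtain ⟨D, ρ, hρ, h⟩ := hS
  exact ⟨D, ρ, hρ, twoVolumeRate_neg h⟩

/-- **Constant multiples** preserve `Rate∃`. [folklore] -/
theorem klre_const_mul (c : ℂ)
    (hS : ∃ D : ℝ, ∃ ρ : ℕ → ℝ, Tendsto ρ atTop (𝓝 0) ∧
      ∀ (L : ℕ) [NeZero L], L₀ ≤ L → ∀ (M : ℕ) [NeZero M], Mth L ≤ M →
        ∀ (L' : ℕ) [NeZero L'], L ≤ L' → ∀ (M' : ℕ) [NeZero M'], Mth L' ≤ M' →
          ∀ (σ : Fin 2) (ω : MatsubaraIdx M) (ω' : MatsubaraIdx M'), matsubaraInt M ω = matsubaraInt M' ω' →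
            ∀ (k : TorusSite 2 L) (k' : TorusSite 2 L'),
              ‖S L M (ω, k) σ - S L' M' (ω', k') σ‖ ≤ ρ L + D * ∑ i, torusAbs (latticeMomentum L k i - latticeMomentum L' k' i)) :
    ∃ D : ℝ, ∃ ρ : ℕ → ℝ, Tendsto ρ atTop (𝓝 0) ∧
      ∀ (L : ℕ) [NeZero L], L₀ ≤ L → ∀ (M : ℕ) [NeZero M], Mth L ≤ M →
        ∀ (L' : ℕ) [NeZero L'], L ≤ L' → ∀ (M' : ℕ) [NeZero M'], Mth L' ≤ M' →
          ∀ (σ : Fin 2) (ω : MatsubaraIdx M) (ω' : MatsubaraIdx M'), matsubaraInt M ω = matsubaraInt M' ω' →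
            ∀ (k : TorusSite 2 L) (k' : TorusSite 2 L'),
              ‖c * S L M (ω, k) σ - c * S L' M' (ω', k') σ‖ ≤ ρ L + D * ∑ i, torusAbs (latticeMomentum L k i - latticeMomentum L' k' i) := by
  obtain ⟨D, ρ, hρ, h⟩ := hS
  exact ⟨‖c‖ * D, fun L => ‖c‖ * ρ L, by simpa using hρ.const_mul ‖c‖, twoVolumeRate_const_mul c h⟩

/-- **Products of bounded families** preserve `Rate∃`. [folklore] -/
theorem klre_mul {BS BT : ℝ} (hBS : 0 ≤ BS)
    (hbS : ∀ (L : ℕ) [NeZero L], L₀ ≤ L → ∀ (M : ℕ) [NeZero M], Mth L ≤ M → ∀ (k : FreqMomentum L M) (σ : Fin 2), ‖S L M k σ‖ ≤ BS)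
    (hbT : ∀ (L : ℕ) [NeZero L], L₀ ≤ L → ∀ (M : ℕ) [NeZero M], Mth L ≤ M → ∀ (k : FreqMomentum L M) (σ : Fin 2), ‖T L M k σ‖ ≤ BT)
    (hS : ∃ D : ℝ, ∃ ρ : ℕ → ℝ, Tendsto ρ atTop (𝓝 0) ∧
      ∀ (L : ℕ) [NeZero L], L₀ ≤ L → ∀ (M : ℕ) [NeZero M], Mth L ≤ M →
        ∀ (L' : ℕ) [NeZero L'], L ≤ L' → ∀ (M' : ℕ) [NeZero M'], Mth L' ≤ M' →
          ∀ (σ : Fin 2) (ω : MatsubaraIdx M) (ω' : MatsubaraIdx M'), matsubaraInt M ω = matsubaraInt M' ω' →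
            ∀ (k : TorusSite 2 L) (k' : TorusSite 2 L'),
              ‖S L M (ω, k) σ - S L' M' (ω', k') σ‖ ≤ ρ L + D * ∑ i, torusAbs (latticeMomentum L k i - latticeMomentum L' k' i))
    (hT : ∃ D : ℝ, ∃ ρ : ℕ → ℝ, Tendsto ρ atTop (𝓝 0) ∧
      ∀ (L : ℕ) [NeZero L], L₀ ≤ L → ∀ (M : ℕ) [NeZero M], Mth L ≤ M →
        ∀ (L' : ℕ) [NeZero L'], L ≤ L' → ∀ (M' : ℕ) [NeZero M'], Mth L' ≤ M' →
          ∀ (σ : Fin 2) (ω : MatsubaraIdx M) (ω' : MatsubaraIdx M'), matsubaraInt M ω = matsubaraInt M' ω' →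
            ∀ (k : TorusSite 2 L) (k' : TorusSite 2 L'),
              ‖T L M (ω, k) σ - T L' M' (ω', k') σ‖ ≤ ρ L + D * ∑ i, torusAbs (latticeMomentum L k i - latticeMomentum L' k' i)) :
    ∃ D : ℝ, ∃ ρ : ℕ → ℝ, Tendsto ρ atTop (𝓝 0) ∧
      ∀ (L : ℕ) [NeZero L], L₀ ≤ L → ∀ (M : ℕ) [NeZero M], Mth L ≤ M →
        ∀ (L' : ℕ) [NeZero L'], L ≤ L' → ∀ (M' : ℕ) [NeZero M'], Mth L' ≤ M' →
          ∀ (σ : Fin 2) (ω : MatsubaraIdx M) (ω' : MatsubaraIdx M'), matsubaraInt M ω = matsubaraInt M' ω' →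
            ∀ (k : TorusSite 2 L) (k' : TorusSite 2 L'),
              ‖S L M (ω, k) σ * T L M (ω, k) σ - S L' M' (ω', k') σ * T L' M' (ω', k') σ‖ ≤
                ρ L + D * ∑ i, torusAbs (latticeMomentum L k i - latticeMomentum L' k' i) := by
  obtain ⟨D₁, ρ₁, hρ₁, h₁⟩ := hS
  obtain ⟨D₂, ρ₂, hρ₂, h₂⟩ := hT
  exact ⟨BT * D₁ + BS * D₂, fun L => BT * ρ₁ L + BS * ρ₂ L, by simpa using (hρ₁.const_mul BT).add (hρ₂.const_mul BS),
    twoVolumeRate_mul hBS hbS hbT h₁ h₂⟩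

/-- **Dressing by a bounded `2π`-periodic Lipschitz symbol read on the grid** preserves `Rate∃` (for a bounded family). [folklore] -/
theorem klre_dressing_mul {B : ℝ} {Φ : ∀ (L M : ℕ) [NeZero L] [NeZero M], FreqMomentum L M → ℂ} {φ : ℤ → (Fin 2 → ℝ) → ℂ}
    {Bφ Kφ : ℝ} (hBφ : 0 ≤ Bφ) (hKφ : 0 ≤ Kφ) (hφb : ∀ (n : ℤ) (p : Fin 2 → ℝ), ‖φ n p‖ ≤ Bφ)
    (hφper : ∀ (n : ℤ) (p : Fin 2 → ℝ) (m : Fin 2 → ℤ), φ n (fun i => p i + m i * (2 * Real.pi)) = φ n p)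
    (hφlip : ∀ (n : ℤ) (p q : Fin 2 → ℝ), ‖φ n p - φ n q‖ ≤ Kφ * ‖p - q‖)
    (hΦ : ∀ (L M : ℕ) [NeZero L] [NeZero M] (ω : MatsubaraIdx M) (k : TorusSite 2 L),
      Φ L M (ω, k) = φ (matsubaraInt M ω) (latticeMomentum L k))
    (hbS : ∀ (L : ℕ) [NeZero L], L₀ ≤ L → ∀ (M : ℕ) [NeZero M], Mth L ≤ M → ∀ (k : FreqMomentum L M) (σ : Fin 2), ‖S L M k σ‖ ≤ B)
    (hS : ∃ D : ℝ, ∃ ρ : ℕ → ℝ, Tendsto ρ atTop (𝓝 0) ∧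
      ∀ (L : ℕ) [NeZero L], L₀ ≤ L → ∀ (M : ℕ) [NeZero M], Mth L ≤ M →
        ∀ (L' : ℕ) [NeZero L'], L ≤ L' → ∀ (M' : ℕ) [NeZero M'], Mth L' ≤ M' →
          ∀ (σ : Fin 2) (ω : MatsubaraIdx M) (ω' : MatsubaraIdx M'), matsubaraInt M ω = matsubaraInt M' ω' →
            ∀ (k : TorusSite 2 L) (k' : TorusSite 2 L'),
              ‖S L M (ω, k) σ - S L' M' (ω', k') σ‖ ≤ ρ L + D * ∑ i, torusAbs (latticeMomentum L k i - latticeMomentum L' k' i)) :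
    ∃ D : ℝ, ∃ ρ : ℕ → ℝ, Tendsto ρ atTop (𝓝 0) ∧
      ∀ (L : ℕ) [NeZero L], L₀ ≤ L → ∀ (M : ℕ) [NeZero M], Mth L ≤ M →
        ∀ (L' : ℕ) [NeZero L'], L ≤ L' → ∀ (M' : ℕ) [NeZero M'], Mth L' ≤ M' →
          ∀ (σ : Fin 2) (ω : MatsubaraIdx M) (ω' : MatsubaraIdx M'), matsubaraInt M ω = matsubaraInt M' ω' →
            ∀ (k : TorusSite 2 L) (k' : TorusSite 2 L'),
              ‖Φ L M (ω, k) * S L M (ω, k) σ - Φ L' M' (ω', k') * S L' M' (ω', k') σ‖ ≤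
                ρ L + D * ∑ i, torusAbs (latticeMomentum L k i - latticeMomentum L' k' i) := by
  obtain ⟨D, ρ, hρ, h⟩ := hS
  exact ⟨Bφ * D + B * Kφ, fun L => Bφ * ρ L, by simpa using hρ.const_mul Bφ,
    twoVolumeRate_dressing_mul hBφ hKφ hφb hφper hφlip hΦ hbS h⟩

end Algebra

/-! ## Generators: grid-exact symbol families, momentum-constant families with an iterated limit -/

/-- **A grid-exact bounded periodic Lipschitz symbol family is in `Rate∃`** (any thresholds; `ρ ≡ 0`). [folklore] -/
theorem klre_of_gridExact {S : ∀ (L M : ℕ) [NeZero L] [NeZero M], FreqMomentum L M → Fin 2 → ℂ} {Mth : ℕ → ℕ} {L₀ : ℕ}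
    {φ : ℤ → (Fin 2 → ℝ) → Fin 2 → ℂ} {Kφ : ℝ} (hKφ : 0 ≤ Kφ)
    (hper : ∀ (n : ℤ) (σ : Fin 2) (p : Fin 2 → ℝ) (m : Fin 2 → ℤ), φ n (fun i => p i + m i * (2 * Real.pi)) σ = φ n p σ)
    (hlip : ∀ (n : ℤ) (σ : Fin 2) (p q : Fin 2 → ℝ), ‖φ n p σ - φ n q σ‖ ≤ Kφ * ‖p - q‖)
    (hS : ∀ (L : ℕ) [NeZero L], L₀ ≤ L → ∀ (M : ℕ) [NeZero M], Mth L ≤ M → ∀ (ω : MatsubaraIdx M) (k : TorusSite 2 L) (σ : Fin 2),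
      S L M (ω, k) σ = φ (matsubaraInt M ω) (latticeMomentum L k) σ) :
    ∃ D : ℝ, ∃ ρ : ℕ → ℝ, Tendsto ρ atTop (𝓝 0) ∧
      ∀ (L : ℕ) [NeZero L], L₀ ≤ L → ∀ (M : ℕ) [NeZero M], Mth L ≤ M →
        ∀ (L' : ℕ) [NeZero L'], L ≤ L' → ∀ (M' : ℕ) [NeZero M'], Mth L' ≤ M' →
          ∀ (σ : Fin 2) (ω : MatsubaraIdx M) (ω' : MatsubaraIdx M'), matsubaraInt M ω = matsubaraInt M' ω' →
            ∀ (k : TorusSite 2 L) (k' : TorusSite 2 L'),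
              ‖S L M (ω, k) σ - S L' M' (ω', k') σ‖ ≤ ρ L + D * ∑ i, torusAbs (latticeMomentum L k i - latticeMomentum L' k' i) :=
  ⟨Kφ, fun _ => 0, tendsto_const_nhds, twoVolumeRate_of_gridExact hKφ hper hlip hS⟩

/-- **A momentum-constant family with an iterated limit is in `Rate∃`** for SOME thresholds `(L₀, Mth)` (from `…ScalarRate`). [folklore] -/
theorem klre_of_iterLimit {a : ∀ (L M : ℕ) [NeZero L] [NeZero M], ℂ} {aInf : ℂ}
    (hl : ∀ ε : ℝ, 0 < ε → ∃ L₁ : ℕ, ∀ (L : ℕ) [NeZero L], L₁ ≤ L →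
      ∃ M₁ : ℕ, ∀ (M : ℕ) [NeZero M], M₁ ≤ M → ‖a L M - aInf‖ ≤ ε) :
    ∃ L₀ : ℕ, ∃ Mth : ℕ → ℕ, ∃ D : ℝ, ∃ ρ : ℕ → ℝ, Tendsto ρ atTop (𝓝 0) ∧
      ∀ (L : ℕ) [NeZero L], L₀ ≤ L → ∀ (M : ℕ) [NeZero M], Mth L ≤ M →
        ∀ (L' : ℕ) [NeZero L'], L ≤ L' → ∀ (M' : ℕ) [NeZero M'], Mth L' ≤ M' →
          ∀ (σ : Fin 2) (ω : MatsubaraIdx M) (ω' : MatsubaraIdx M'), matsubaraInt M ω = matsubaraInt M' ω' →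
            ∀ (k : TorusSite 2 L) (k' : TorusSite 2 L'),
              ‖(fun (L M : ℕ) (_ : NeZero L) (_ : NeZero M) (_ : FreqMomentum L M) (_ : Fin 2) => a L M) L M ‹_› ‹_› (ω, k) σ -
                  (fun (L M : ℕ) (_ : NeZero L) (_ : NeZero M) (_ : FreqMomentum L M) (_ : Fin 2) => a L M) L' M' ‹_› ‹_› (ω', k') σ‖ ≤
                ρ L + D * ∑ i, torusAbs (latticeMomentum L k i - latticeMomentum L' k' i) := by
  obtain ⟨L₀, Mth, ρ, hρ, _, h⟩ := twoVolumeRate_of_iterLimit hl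
  exact ⟨L₀, Mth, 0, ρ, hρ, fun L _ hL M _ hM L' _ hLL' M' _ hM' σ ω ω' hωω' k k' => h L hL M hM L' hLL' M' hM' σ ω ω' hωω' k k'⟩

end Summit.HubbardSuperconductivity.HubbardSuperconductivity.Theorems.KLRegimeSplit

end
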